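import Summits.RiemannHypothesis.RiemannHypothesis.Theorems.SemilocalNegCertSeventeenKinked1478
import HarnessLib

/-!
# Semi-local threshold of the `{∞,2,…,17}` form, negative side: `a*({2,…,17}) ≤ 1513/1024` — the wall `q = 19` from a KINKED (piecewise-cubic) witness (part 7/14: the kernel facts piece 73 … piece 84 of 145 (imports part 1 only))

Cell `rh-explicit` (HOME `run/shared/lean/pub/rh-explicit/`), seat cc-s2-9 gen0 (HUMAN RULING D-0074 (D5) WEIL data engine; LADDER-RH column WEIL, rung DATA → W-P(P2);
pipeline = cc-s2-4 gen8/gen11's piecewise-witness layer `SemilocalPiecewise{Witness,Increment,IncrementSum,Cert}.lean` + their float finder, every number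
re-derived by an independent second engine E2 before filing).  HONEST FRAMING: RH-FREE theorems about the tree's `weilSemilocalThreshold S` of a
TRUNCATED Weil form (finitely many places); nothing here bears on the truth of RH; the lower clause `(log q)/2 ≤ a*(S_q)` at all primes IS RH and is untouched.

WHY KINKED (cc-s2-4 `KNEE-NOTE`): at `b ≈ a*(S_19) + 0.005` the polynomial × indicator class is still flat (tree row `95/64` at degree 17,
`SemilocalNegCertSeventeen`, `δ*(19) ≤ 0.0122`), whereas an odd piecewise cubic with slope breaks at ALL ELEVEN atom images `|b − log n|`
(`n = 4, 17, 5, 16, 3, 7, 13, 8, 2, 9, 11`, rounded to `/1024`) is negative by `7.0·10⁻⁴‖G‖²`.  Instance: `S = {2,3,5,7,11,13,17}`, `b = 1513/1024 = 1.4775390625`,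
`N = 19` (atom table `atomsSeventeen` / `atomsEnclose_Seventeen` of `SemilocalNegCertSeventeen.lean`), 12 pieces of degree ≤ 3, 145 `t`-pieces; TWO ENGINES on the
witness before the kernel: cc-s2-4's float finder `λ_min = −6.9794·10⁻⁴` (kit j249062) and this seat's exact-in-`x` decimal engine E2 `R = −7.0020·10⁻⁴`
(no polar credit; E2 reproduces the tree rows `certSeventeen` → −3.7949·10⁻⁵ and `certElevenKinked129` → −3.5513·10⁻³); exact kernel margin `(rhs − lhs)/‖G‖² = 6.968·10⁻⁴`
(farm report; majorant slack 3.4·10⁻⁶).  ⇒ **`a*({2,…,17}) ≤ 1513/1024`, `δ*(19) = a*(S_19) − (log 19)/2 ≤ 0.00532`** (was `0.0122`); DATA (cc-s2-6/cc-s2-3, two engines):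
`a*(S_19) ∈ (1.47245, 1.472475]`, `δ*(19) ≈ 2.4·10⁻⁴`.  No data is trusted: every bound is a `decide +kernel` fact of `SemilocalPiecewiseCert.lean`.  Folklore throughout.
-/

set_option autoImplicit false
set_option linter.dupNamespace false  -- the mandated namespace repeats `RiemannHypothesis`
set_option Elab.async false  -- serialise the kernel facts: in parallel they exhaust the node's per-process heap (cc-s2-4 gen11, CC4-LEAN §16.10)

noncomputable section

open Complex Filter Set MeasureTheory Topology
open scoped Real

namespace Summit.RiemannHypothesis.RiemannHypothesis.Theorems.SemilocalPolyWitness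

open MeasureTheory Set Finset Real
open Literature.NumberTheory.LFunctions
open Summit.RiemannHypothesis.RiemannHypothesis.Theorems.MotivicDoor
open Summit.RiemannHypothesis.RiemannHypothesis.Theorems.MotivicDoor.SemilocalThreshold
open Summit.RiemannHypothesis.RiemannHypothesis.Theorems.MotivicDoor.SemilocalMarkov
open LQ

set_option maxHeartbeats 0 in
/-- kernel fact: piece `73` of `certSeventeenKinked1478`. -/
theorem check_SeventeenKinked1478_piece73 : certSeventeenKinked1478.checkPiecePW 73 = true := by
  decide +kernel

set_option maxHeartbeats 0 in
/-- kernel fact: piece `74` of `certSeventeenKinked1478`. -/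
theorem check_SeventeenKinked1478_piece74 : certSeventeenKinked1478.checkPiecePW 74 = true := by
  decide +kernel

set_option maxHeartbeats 0 in
/-- kernel fact: piece `75` of `certSeventeenKinked1478`. -/
theorem check_SeventeenKinked1478_piece75 : certSeventeenKinked1478.checkPiecePW 75 = true := by
  decide +kernel

set_option maxHeartbeats 0 in
/-- kernel fact: piece `76` of `certSeventeenKinked1478`. -/
theorem check_SeventeenKinked1478_piece76 : certSeventeenKinked1478.checkPiecePW 76 = true := by
  decide +kernel

set_option maxHeartbeats 0 in
/-- kernel fact: piece `77` of `certSeventeenKinked1478`. -/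
theorem check_SeventeenKinked1478_piece77 : certSeventeenKinked1478.checkPiecePW 77 = true := by
  decide +kernel

set_option maxHeartbeats 0 in
/-- kernel fact: piece `78` of `certSeventeenKinked1478`. -/
theorem check_SeventeenKinked1478_piece78 : certSeventeenKinked1478.checkPiecePW 78 = true := by
  decide +kernel

set_option maxHeartbeats 0 in
/-- kernel fact: piece `79` of `certSeventeenKinked1478`. -/
theorem check_SeventeenKinked1478_piece79 : certSeventeenKinked1478.checkPiecePW 79 = true := by
  decide +kernel

set_option maxHeartbeats 0 in
/-- kernel fact: piece `80` of `certSeventeenKinked1478`. -/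
theorem check_SeventeenKinked1478_piece80 : certSeventeenKinked1478.checkPiecePW 80 = true := by
  decide +kernel

set_option maxHeartbeats 0 in
/-- kernel fact: piece `81` of `certSeventeenKinked1478`. -/
theorem check_SeventeenKinked1478_piece81 : certSeventeenKinked1478.checkPiecePW 81 = true := by
  decide +kernel

set_option maxHeartbeats 0 in
/-- kernel fact: piece `82` of `certSeventeenKinked1478`. -/
theorem check_SeventeenKinked1478_piece82 : certSeventeenKinked1478.checkPiecePW 82 = true := by
  decide +kernel

set_option maxHeartbeats 0 in
/-- kernel fact: piece `83` of `certSeventeenKinked1478`. -/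
theorem check_SeventeenKinked1478_piece83 : certSeventeenKinked1478.checkPiecePW 83 = true := by
  decide +kernel

set_option maxHeartbeats 0 in
/-- kernel fact: piece `84` of `certSeventeenKinked1478`. -/
theorem check_SeventeenKinked1478_piece84 : certSeventeenKinked1478.checkPiecePW 84 = true := by
  decide +kernel

end Summit.RiemannHypothesis.RiemannHypothesis.Theorems.SemilocalPolyWitness

end
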